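import Mathlib.Analysis.SpecialFunctions.Pow.Real
import Summits.Ventures.Crystal3D.StickySpheres.ContactGraph
import Literature.MathematicalPhysics.StatisticalMechanics.BarlowCoordination
import Literature.Probability.LatticeModels.LoomisWhitney
import HarnessLib

/-!
# Sub-clusters of the fcc packing have at most `6N − 6N^{2/3}` contacts (discrete Loomis–Whitney)

HONEST FRAMING. Part of the venture `Summits/Ventures/Crystal3D` (cells `pub-crystal3d`,
`crystal3d-full`). An ON-LATTICE surface bound; nothing here is a claim about off-lattice packings,
ground states, or three-dimensional crystallization.

**Theorem** (`numContacts_le_of_mem_fccStacking`). Every unit packing `x : Fin N → ℝ³` whose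
centres lie in the face-centred cubic packing `fccStacking 1 √(2/3)` (touching stacking: in-layer
spacing `1`, layer spacing `√(2/3)`) has `numContacts x ≤ 6N − 6N^{2/3}`, i.e. contact deficiency
`6N − C ≥ 6 N^{2/3}`, for EVERY `N` (equality at `N = 1`).  This is the statement
`FccLoomisWhitneyBound` of the cell's route memo (HOME/cf-p1/ROUTE.md §3.1, §22; typed in
HOME/cf-p1/lean/WulffSelection.lean); it improves, for the fcc lattice and all `N`, the constant
`3.665…` of Bezdek's lattice bound `C < 6N − 3.665 N^{2/3}` (K. Bezdek, *Contact numbers for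
congruent sphere packings in Euclidean 3-space*, DCG 48 (2012), Thm 1.1 (ii)) to the optimal
all-`N` constant `6` (since `C(1) = 0`); the true surface constant is `∛432 = 7.5595…` at leading
order (Cicalese–Kreutz–Leonardi 2023; `Literature/…/StickyWulffConstants.lean`).

**Proof** (lit seat's pointer, HOME/cf-lit/LIT.md §7 A13). Write the centres in the integer chart
`(k, i, j) ↦ barlowPos 1 √(2/3) constHagg k i j` of the stacking.  By the distance form of
`BarlowCoordination.lean` (`12·dist² = 3(2P+Q+K)² + (3Q+K)² + 8K²` in the differences
`K, P, Q`), two sites touch iff their difference is one of twelve offsets, and these split into the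
`±` unit steps of TWO unimodular coordinate systems of `ℤ³`:
`ψ₁(k,i,j) = (i, j+k, −k)` (steps `(0,±1,0), (0,0,±1), ∓(1,0,−1)`) and
`ψ₂(k,i,j) = (k+i+j, i+j, −j)` (steps `(±1,0,0), ∓(1,−1,0), ±(0,1,−1)`)
(`step_of_fccForm_eq_twelve`).  Hence `Σ_i deg(i) ≤ Σ_i (#ψ₁-step neighbours + #ψ₂-step
neighbours)`, and for an injective `a : Fin N → ℤ^d` the step neighbours and the boundary pairs of
the image set together fill all `2dN` slots (`sum_card_stepNeighbors_add_card_boundaryPairs`).  The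
tree's sharp edge-isoperimetric inequality in `ℤ³`
(`Literature.Probability.LatticeModels.two_mul_card_mul_rpow_le_card_boundaryPairs`, from the
discrete Loomis–Whitney inequality) gives `≥ 6N^{2/3}` boundary pairs in each chart, so
`2C ≤ 12N − 12N^{2/3}`.

WHAT THIS IS NOT: not a bound for general packings (`SurfaceBoundSix`, `C ≤ 6N − 6N^{2/3}` for
all unit packings, remains a conjecture); not the sharp leading-order constant `∛432`.
-/

noncomputable section

namespace Summit.Ventures.Crystal3D

open Finset
open Literature.Probability.LatticeModels (Site unitStep unitStep_apply boundaryPairs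
  two_mul_card_mul_rpow_le_card_boundaryPairs)
open Literature.MathematicalPhysics.StatisticalMechanics (barlowPos barlowStacking fccStacking
  constHagg haggLabel_const dist_barlowPos_eq_iff_form)

/-! ## Slot counting in `ℤ^d` -/

/-- The encoding `(k, b) ↦ ± e_k` of unit steps is injective. -/
theorem unitStep_inj {d : ℕ} {k k' : Fin d} {b b' : Bool}
    (h : unitStep k b = unitStep k' b') : k = k' ∧ b = b' := by
  have hk := congrFun h k
  rw [unitStep_apply, unitStep_apply, if_pos rfl] at hk
  by_cases hkk : k = k'
  · subst hkk
    rw [if_pos rfl] at hk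
    refine ⟨rfl, ?_⟩
    cases b <;> cases b' <;> first | rfl | (simp at hk)
  · rw [if_neg hkk] at hk
    cases b <;> simp at hk

/-- **Slot counting.** For an injective family `a : Fin N → ℤ^d`, every one of the `2dN` slots
`(a i, ±e_k)` is either occupied by some `a j = a i ± e_k` or is a boundary pair of the image set:
`Σ_i #{j | ∃ k b, a j = a i + unitStep k b} + #boundaryPairs (range a) = 2dN`. -/
theorem sum_card_stepNeighbors_add_card_boundaryPairs {d N : ℕ} (a : Fin N → Site d)
    (ha : Function.Injective a) :
    ∑ i, (univ.filter fun j => ∃ k : Fin d, ∃ b : Bool, a j = a i + unitStep k b).card +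
      (boundaryPairs (univ.image a)).card = 2 * d * N := by
  classical
  set A : Finset (Site d) := univ.image a with hA
  have hAcard : A.card = N := by
    rw [hA, card_image_of_injective _ ha, card_univ, Fintype.card_fin]
  set occ : Finset (Site d × Fin d × Bool) :=
    (A ×ˢ (univ : Finset (Fin d × Bool))).filter fun t => t.1 + unitStep t.2.1 t.2.2 ∈ A
    with hocc
  -- occupied slots + boundary pairs = all slots
  have hsplit : occ.card + (boundaryPairs A).card = 2 * d * N := by
    have h := card_filter_add_card_filter_not (s := A ×ˢ (univ : Finset (Fin d × Bool)))
      (fun t => t.1 + unitStep t.2.1 t.2.2 ∈ A)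
    rw [card_product, hAcard, card_univ, Fintype.card_prod, Fintype.card_fin,
      Fintype.card_bool] at h
    have hbp : boundaryPairs A =
        (A ×ˢ (univ : Finset (Fin d × Bool))).filter fun t => ¬ t.1 + unitStep t.2.1 t.2.2 ∈ A :=
      rfl
    rw [← hocc] at h
    rw [hbp, h]
    ring
  -- occupied slots, counted ball by ball
  have hfiber : occ.card = ∑ y ∈ A, (occ.filter fun t => t.1 = y).card :=
    card_eq_sum_card_fiberwise fun t ht => by
      have := (mem_filter.1 (mem_coe.1 ht)).1
      exact mem_coe.2 (mem_product.1 this).1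
  have hsum : ∑ y ∈ A, (occ.filter fun t => t.1 = y).card =
      ∑ i, (occ.filter fun t => t.1 = a i).card := by
    rw [hA, sum_image fun i _ j _ h => ha h]
  have hpt : ∀ i, (occ.filter fun t => t.1 = a i).card =
      (univ.filter fun j => ∃ k : Fin d, ∃ b : Bool, a j = a i + unitStep k b).card := by
    intro i
    have hinj : Set.InjOn (fun t : Site d × Fin d × Bool => t.1 + unitStep t.2.1 t.2.2)
        ↑(occ.filter fun t => t.1 = a i) := by
      intro t ht t' ht' heq
      have h1 : t.1 = a i := (mem_filter.1 (mem_coe.1 ht)).2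
      have h1' : t'.1 = a i := (mem_filter.1 (mem_coe.1 ht')).2
      have hst : unitStep t.2.1 t.2.2 = unitStep t'.2.1 t'.2.2 := by
        have : t.1 + unitStep t.2.1 t.2.2 = t'.1 + unitStep t'.2.1 t'.2.2 := heq
        rw [h1, h1'] at this
        exact add_left_cancel this
      obtain ⟨hk, hb⟩ := unitStep_inj hst
      exact Prod.ext (h1.trans h1'.symm) (Prod.ext hk hb)
    have himage : (occ.filter fun t => t.1 = a i).image
        (fun t : Site d × Fin d × Bool => t.1 + unitStep t.2.1 t.2.2) =
        (univ.filter fun j => ∃ k : Fin d, ∃ b : Bool, a j = a i + unitStep k b).image a := by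
      ext y
      simp only [mem_image, mem_filter, mem_univ, true_and]
      constructor
      · rintro ⟨t, ⟨ht, ht1⟩, rfl⟩
        rw [hocc, mem_filter] at ht
        obtain ⟨j, -, hj⟩ := mem_image.1 ht.2
        exact ⟨j, ⟨t.2.1, t.2.2, by rw [hj, ht1]⟩, hj⟩
      · rintro ⟨j, ⟨k, b, hj⟩, rfl⟩
        refine ⟨(a i, k, b), ⟨?_, rfl⟩, hj.symm⟩
        rw [hocc, mem_filter, mem_product]
        refine ⟨⟨?_, mem_univ _⟩, ?_⟩
        · exact mem_image_of_mem _ (mem_univ i)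
        · show a i + unitStep k b ∈ A
          rw [← hj]
          exact mem_image_of_mem _ (mem_univ j)
    rw [← card_image_of_injOn hinj, himage, card_image_of_injective _ ha]
  rw [hfiber, hsum] at hsplit
  simp only [hpt] at hsplit
  exact hsplit

/-! ## The twelve fcc contact offsets are the unit steps of two charts -/

/-- **The bridge.** If the fcc distance form `3(2P+Q+K)² + (3Q+K)² + 8K²` of the differences
`K = k' − k`, `P = i' − i`, `Q = j' − j` equals `12` (touching sites, `BarlowCoordination`), then
the difference is a `±` unit step either in the chart `ψ₁ = (i, j+k, −k)` or in the chart
`ψ₂ = (k+i+j, i+j, −j)`: the twelve solutions are `(K,P,Q) = ±(1,0,0), ±(0,1,0), ±(0,0,1),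
±(1,−1,0), ±(1,0,−1), ±(0,1,−1)`, six for each chart. -/
theorem step_of_fccForm_eq_twelve (K P Q : ℤ)
    (h : 3 * (2 * P + Q + K) ^ 2 + (3 * Q + K) ^ 2 + 8 * K ^ 2 = 12) :
    (∃ k : Fin 3, ∃ b : Bool, (![P, Q + K, -K] : Site 3) = unitStep k b) ∨
      (∃ k : Fin 3, ∃ b : Bool, (![K + P + Q, P + Q, -Q] : Site 3) = unitStep k b) := by
  have hK2 : K ^ 2 ≤ 1 := by nlinarith [sq_nonneg (2 * P + Q + K), sq_nonneg (3 * Q + K)]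
  have hQ2 : (3 * Q + K) ^ 2 ≤ 12 := by nlinarith [sq_nonneg (2 * P + Q + K), sq_nonneg K]
  have hP2 : 3 * (2 * P + Q + K) ^ 2 ≤ 12 := by nlinarith [sq_nonneg (3 * Q + K), sq_nonneg K]
  have hK : -1 ≤ K ∧ K ≤ 1 := by constructor <;> nlinarith
  have hQK : -3 ≤ 3 * Q + K ∧ 3 * Q + K ≤ 3 := by constructor <;> nlinarith
  have hPQK : -2 ≤ 2 * P + Q + K ∧ 2 * P + Q + K ≤ 2 := by constructor <;> nlinarith
  have hQ : -1 ≤ Q ∧ Q ≤ 1 := by omega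
  have hP : -2 ≤ P ∧ P ≤ 2 := by omega
  obtain ⟨hK1, hK2'⟩ := hK
  obtain ⟨hQ1, hQ2'⟩ := hQ
  obtain ⟨hP1, hP2'⟩ := hP
  interval_cases K <;> interval_cases P <;> interval_cases Q <;> first | decide | (norm_num at h)

/-! ## The bound -/

/-- **`FccLoomisWhitneyBound`: sub-clusters of the fcc packing have at most `6N − 6N^{2/3}`
contacts.**  For every `N` and every unit packing `x : Fin N → ℝ³` with all centres in
`fccStacking 1 √(2/3)`, `numContacts x ≤ 6N − 6N^{2/3}`. -/
theorem numContacts_le_of_mem_fccStacking {N : ℕ} (x : Fin N → EuclideanSpace ℝ (Fin 3))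
    (hx : IsUnitPacking x) (hmem : ∀ i, x i ∈ fccStacking 1 (Real.sqrt (2 / 3))) :
    (numContacts x : ℝ) ≤ 6 * (N : ℝ) - 6 * (N : ℝ) ^ ((2 : ℝ) / 3) := by
  classical
  -- the empty packing
  rcases Nat.eq_zero_or_pos N with rfl | hNpos
  · have h0 : numContacts x = 0 := by
      rw [numContacts, contactPairs, Finset.card_eq_zero, Finset.filter_eq_empty_iff]
      intro p; exact Fin.elim0 p.1
    rw [h0]; simp [Real.zero_rpow (by norm_num : (2 : ℝ) / 3 ≠ 0)]
  -- integer coordinates of the centres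
  have hcoord : ∀ i, ∃ k p q : ℤ, x i = barlowPos 1 (Real.sqrt (2 / 3)) constHagg k p q :=
    fun i => hmem i
  choose kf pf qf hc using hcoord
  -- the touching stacking has the ideal layer spacing of `BarlowCoordination`
  have hh : (Real.sqrt (2 / 3)) ^ 2 = 2 / 3 * (1 : ℝ) ^ 2 := by
    rw [Real.sq_sqrt (by norm_num)]; ring
  -- the two charts
  set a₁ : Fin N → Site 3 := fun i => ![pf i, qf i + kf i, -kf i] with ha₁
  set a₂ : Fin N → Site 3 := fun i => ![kf i + pf i + qf i, pf i + qf i, -qf i] with ha₂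
  have hinjx := hx.injective
  have hcoord_inj : ∀ i j, kf i = kf j → pf i = pf j → qf i = qf j → i = j := by
    intro i j h1 h2 h3
    apply hinjx
    rw [hc i, hc j, h1, h2, h3]
  have ha₁inj : Function.Injective a₁ := by
    intro i j h
    have h0 := congrFun h 0
    have h1 := congrFun h 1
    have h2 := congrFun h 2
    simp only [ha₁, Matrix.cons_val_zero, Matrix.cons_val_one, Matrix.cons_val] at h0 h1 h2
    exact hcoord_inj i j (by omega) h0 (by omega)
  have ha₂inj : Function.Injective a₂ := by
    intro i j h
    have h0 := congrFun h 0
    have h1 := congrFun h 1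
    have h2 := congrFun h 2
    simp only [ha₂, Matrix.cons_val_zero, Matrix.cons_val_one, Matrix.cons_val] at h0 h1 h2
    exact hcoord_inj i j (by omega) (by omega) (by omega)
  -- a contact is a unit step in one of the two charts
  have hstep : ∀ i j, dist (x i) (x j) = 1 →
      (∃ k : Fin 3, ∃ b : Bool, a₁ j = a₁ i + unitStep k b) ∨
        (∃ k : Fin 3, ∃ b : Bool, a₂ j = a₂ i + unitStep k b) := by
    intro i j hd
    rw [dist_comm, hc j, hc i, dist_barlowPos_eq_iff_form one_pos hh constHagg,
      haggLabel_const, haggLabel_const] at hd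
    rcases step_of_fccForm_eq_twelve _ _ _ hd with ⟨k, b, h⟩ | ⟨k, b, h⟩
    · refine Or.inl ⟨k, b, ?_⟩
      ext l
      rw [Pi.add_apply, ← congrFun h l]
      fin_cases l <;> simp [ha₁] <;> ring
    · refine Or.inr ⟨k, b, ?_⟩
      ext l
      rw [Pi.add_apply, ← congrFun h l]
      fin_cases l <;> simp [ha₂] <;> ring
  -- degree of each ball ≤ step neighbours in chart 1 + chart 2
  have hdeg : ∀ i, coordination x i ≤
      (univ.filter fun j => ∃ k : Fin 3, ∃ b : Bool, a₁ j = a₁ i + unitStep k b).card +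
        (univ.filter fun j => ∃ k : Fin 3, ∃ b : Bool, a₂ j = a₂ i + unitStep k b).card := by
    intro i
    refine (card_le_card fun j hj => ?_).trans (card_union_le _ _)
    rw [mem_contactNeighbors] at hj
    rw [mem_union, mem_filter, mem_filter]
    rcases hstep i j hj.2 with h | h
    · exact Or.inl ⟨mem_univ _, h⟩
    · exact Or.inr ⟨mem_univ _, h⟩
  -- summing: 2C + #∂₁ + #∂₂ ≤ 12 N
  have h1 := sum_card_stepNeighbors_add_card_boundaryPairs a₁ ha₁inj
  have h2 := sum_card_stepNeighbors_add_card_boundaryPairs a₂ ha₂inj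
  have hhand := sum_coordination_eq x
  have hsumdeg : ∑ i, coordination x i ≤
      ∑ i, (univ.filter fun j => ∃ k : Fin 3, ∃ b : Bool, a₁ j = a₁ i + unitStep k b).card +
        ∑ i, (univ.filter fun j => ∃ k : Fin 3, ∃ b : Bool, a₂ j = a₂ i + unitStep k b).card := by
    rw [← sum_add_distrib]; exact sum_le_sum fun i _ => hdeg i
  have hnat : 2 * numContacts x + (boundaryPairs (univ.image a₁)).card +
      (boundaryPairs (univ.image a₂)).card ≤ 12 * N := by omega
  -- the sharp edge-isoperimetric inequality in each chart
  have hcard₁ : (univ.image a₁).card = N := by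
    rw [card_image_of_injective _ ha₁inj, card_univ, Fintype.card_fin]
  have hcard₂ : (univ.image a₂).card = N := by
    rw [card_image_of_injective _ ha₂inj, card_univ, Fintype.card_fin]
  have hne₁ : (univ.image a₁).Nonempty := card_pos.1 (by rw [hcard₁]; exact hNpos)
  have hne₂ : (univ.image a₂).Nonempty := card_pos.1 (by rw [hcard₂]; exact hNpos)
  have hexp : (((3 : ℕ) : ℝ) - 1) / ((3 : ℕ) : ℝ) = (2 : ℝ) / 3 := by norm_num
  have hiso₁ := two_mul_card_mul_rpow_le_card_boundaryPairs (d := 3) (by norm_num) _ hne₁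
  have hiso₂ := two_mul_card_mul_rpow_le_card_boundaryPairs (d := 3) (by norm_num) _ hne₂
  rw [hcard₁, hexp] at hiso₁
  rw [hcard₂, hexp] at hiso₂
  have hreal : (2 * numContacts x + (boundaryPairs (univ.image a₁)).card +
      (boundaryPairs (univ.image a₂)).card : ℝ) ≤ 12 * N := by exact_mod_cast hnat
  push_cast at hiso₁ hiso₂ hreal
  linarith

end Summit.Ventures.Crystal3D

end
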